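/-
Copyright: the b2b-balaban T⁴-continuum CRUX team, row NE7b OWNER lineage `t4-ne7b-p1` (gen 130). Project licence.
-/
import Mathlib.Analysis.SpecialFunctions.Log.Deriv
import Mathlib.Algebra.Order.Chebyshev

/-!
# THE THIRD DERIVATIVE OF `log Z` ALONG A LINE — THE QUOTIENT BOOKKEEPING AND THE DETERMINISTIC LETTERS: for `Z > 0` at `t₀` with
# `Z′ = Z₁`, `Z₁′ = Z₂`, `Z₂′(t₀) = z₃` there, `(log Z)′ = Z₁∕Z`, `(Z₁∕Z)′ = (Z₂Z − Z₁²)∕Z²` and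
#   `((Z₂Z − Z₁²)∕Z²)′(t₀) = (z₃Z² − 3ZZ₁Z₂ + 2Z₁³)∕Z³`,  `|(log Z)‴(t₀)| ≤ |z₃|∕Z + 3(|Z₁|∕Z)(|Z₂|∕Z) + 2(|Z₁|∕Z)³`
# — with (336b)'s `Z₁ = ∫e^{−V}(−A)`, `Z₂ = ∫e^{−V}(A²−B)`, `z₃ = ∫e^{−V}(−A³+3AB−C)` the three quotients are tilted expectations, and the power
# means `|A| ≤ κ₁Σ|h||u|`, `(Σ_Y c)^{k} ≤ #Y^{k−1}Σ_Y c^{k}` put them under single-site tilted moments (row NE7b, node U5c; Mathlib only; [folklore])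

Cell `pub-balaban`, sub-cell `t4`, spine estimate NE7b (`T4WeightBudget.RelWeightBound`; the cell's OWN estimate — NOT PRINTED in
[Bałaban 1983–89], NOT PROVED).  Crux-route work under `Spine/NE7b/` by the row OWNER (`t4-ne7b-p1` gen 130, file (337a)) under FREEZE
(0)'s crux-prover clause, on § [NE7bP1-G130-HANDOFF] NEXT (3)(a); NOTHING of Bałaban's is named as a Lean object, valued or asserted; no
`T4Continuum/Support` leaf typed; no `def`, no notation; zero `sorry`.  Imports: Mathlib only (`Real.hasDerivAt_log`, `HasDerivAt.div`,
`pow_sum_le_card_mul_sum_pow`).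

WHAT IS PROVED ([folklore]):
* §1 `hasDerivAt_log_of` (`(log Z)′ = Z₁∕Z`), `hasDerivAt_logDeriv_of` (`(Z₁∕Z)′ = (Z₂Z − Z₁Z₁)∕Z²`), **`hasDerivAt_logSecond_of`**
  (`((Z₂Z − Z₁Z₁)∕Z²)′(t₀) = (z₃Z² − 3ZZ₁Z₂ + 2Z₁³)∕Z³`), **`abs_logThird_le`** (`|(z₃Z² − 3ZZ₁Z₂ + 2Z₁³)∕Z³| ≤ |z₃|∕Z + 3(|Z₁|∕Z)(|Z₂|∕Z) + 2(|Z₁|∕Z)³`);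
* §2 the deterministic letters for `A = Σ_Y w′_x(u_x)h_x` with `|w′_x(u)| ≤ κ₁|u|`: `abs_lin_le` (`|A| ≤ κ₁Σ|h_x||u_x|`), `abs_lin_sq_le`
  (`|A|·|A| ≤ κ₁²·#Y·Σh_x²u_x²`), `abs_lin_cube_le` (`|A|·|A|·|A| ≤ κ₁³·#Y²·Σ|h_x|³|u_x|³`); §3 toy.

HONEST (what this is NOT).  Calculus and power means; the expectations are bounded in the next file by the road's single-site tilted letters;
the resulting cubic letter is O(1) (no constant improvement on the same sites); scalar skeleton ((A3), NC-NE7b-α UNRULED); nothing of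
Bałaban's asserted.  BY-NAME EFFECT ON THE WALL: NONE.  NE7b NOT PRINTED ∕ NOT PROVED; spine PROVED 0∕9; rung (B)+1 — the programme's measures
remain FINITE-torus statements; NOT the mass gap, NOT Clay.  HONEST DEPENDENCY: continuum YM on T⁴ ⇐ BetaPertH ∧ nine spine estimates
(0∕9 proved); BetaPertH ⇐ (D1) ∧ (D4) ∧ CAP+tail; G-an2-4 gates asym, D1 and NE2∕3∕4.
-/

set_option autoImplicit false

noncomputable section

namespace Summit.QuantumFields.BalabanUV.T4Continuum.NE7b.SupLogThirdDerivative

open Finset Real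
open scoped BigOperators

/-! ## §1. The quotient bookkeeping -/

/-- `(log Z)′(t₀) = Z₁(t₀)∕Z(t₀)` (`Z(t₀) > 0`). [folklore] -/
theorem hasDerivAt_log_of {Z Z₁ : ℝ → ℝ} {t₀ : ℝ} (hZ : HasDerivAt Z (Z₁ t₀) t₀) (hpos : 0 < Z t₀) :
    HasDerivAt (fun t => log (Z t)) (Z₁ t₀ / Z t₀) t₀ := by
  have h := (hasDerivAt_log hpos.ne').comp t₀ hZ
  rw [mul_comm, ← div_eq_mul_inv] at h
  exact h

/-- `(Z₁∕Z)′(t₀) = (Z₂Z − Z₁Z₁)∕Z²`. [folklore] -/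
theorem hasDerivAt_logDeriv_of {Z Z₁ Z₂ : ℝ → ℝ} {t₀ : ℝ} (hZ : HasDerivAt Z (Z₁ t₀) t₀) (hZ₁ : HasDerivAt Z₁ (Z₂ t₀) t₀)
    (hpos : 0 < Z t₀) :
    HasDerivAt (fun t => Z₁ t / Z t) ((Z₂ t₀ * Z t₀ - Z₁ t₀ * Z₁ t₀) / Z t₀ ^ 2) t₀ :=
  hZ₁.div hZ hpos.ne'

/-- **`((Z₂Z − Z₁Z₁)∕Z²)′(t₀) = (z₃Z² − 3ZZ₁Z₂ + 2Z₁³)∕Z³`** (`Z₂′(t₀) = z₃`, `Z(t₀) > 0`). [folklore] -/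
theorem hasDerivAt_logSecond_of {Z Z₁ Z₂ : ℝ → ℝ} {z₃ t₀ : ℝ} (hZ : HasDerivAt Z (Z₁ t₀) t₀) (hZ₁ : HasDerivAt Z₁ (Z₂ t₀) t₀)
    (hZ₂ : HasDerivAt Z₂ z₃ t₀) (hpos : 0 < Z t₀) :
    HasDerivAt (fun t => (Z₂ t * Z t - Z₁ t * Z₁ t) / Z t ^ 2)
      ((z₃ * Z t₀ ^ 2 - 3 * Z t₀ * Z₁ t₀ * Z₂ t₀ + 2 * Z₁ t₀ ^ 3) / Z t₀ ^ 3) t₀ := by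
  have hnum : HasDerivAt (fun t => Z₂ t * Z t - Z₁ t * Z₁ t) (z₃ * Z t₀ + Z₂ t₀ * Z₁ t₀ - (Z₂ t₀ * Z₁ t₀ + Z₁ t₀ * Z₂ t₀)) t₀ :=
    (hZ₂.mul hZ).sub (hZ₁.mul hZ₁)
  have hden : HasDerivAt (fun t => Z t ^ 2) (2 * Z t₀ * Z₁ t₀) t₀ := by
    have h := hZ.pow 2
    refine h.congr_deriv ?_
    push_cast
    ring
  have hq := hnum.div hden (pow_ne_zero 2 hpos.ne')
  refine hq.congr_deriv ?_
  have hZ0 : Z t₀ ≠ 0 := hpos.ne'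
  field_simp
  ring

/-- **The deterministic third-order letter**: `Z > 0` ⟹ `|(z₃Z² − 3ZZ₁Z₂ + 2Z₁³)∕Z³| ≤ |z₃|∕Z + 3(|Z₁|∕Z)(|Z₂|∕Z) + 2(|Z₁|∕Z)³`. [folklore] -/
theorem abs_logThird_le {Z Z₁ Z₂ z₃ : ℝ} (hpos : 0 < Z) :
    |(z₃ * Z ^ 2 - 3 * Z * Z₁ * Z₂ + 2 * Z₁ ^ 3) / Z ^ 3| ≤ |z₃| / Z + 3 * (|Z₁| / Z) * (|Z₂| / Z) + 2 * (|Z₁| / Z) ^ 3 := by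
  have e : (z₃ * Z ^ 2 - 3 * Z * Z₁ * Z₂ + 2 * Z₁ ^ 3) / Z ^ 3 = z₃ / Z - 3 * (Z₁ / Z) * (Z₂ / Z) + 2 * (Z₁ / Z) ^ 3 := by
    field_simp
  rw [e]
  have t1 := abs_add_le (z₃ / Z - 3 * (Z₁ / Z) * (Z₂ / Z)) (2 * (Z₁ / Z) ^ 3)
  have t2 := abs_sub (z₃ / Z) (3 * (Z₁ / Z) * (Z₂ / Z))
  have e1 : |z₃ / Z| = |z₃| / Z := by rw [abs_div, abs_of_pos hpos]
  have e2 : |3 * (Z₁ / Z) * (Z₂ / Z)| = 3 * (|Z₁| / Z) * (|Z₂| / Z) := by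
    rw [abs_mul, abs_mul, abs_of_pos (by norm_num : (0 : ℝ) < 3), abs_div, abs_div, abs_of_pos hpos]
  have e3 : |2 * (Z₁ / Z) ^ 3| = 2 * (|Z₁| / Z) ^ 3 := by
    rw [abs_mul, abs_of_pos (by norm_num : (0 : ℝ) < 2), abs_pow, abs_div, abs_of_pos hpos]
  linarith

/-! ## §2. The deterministic letters for the linear observable -/

section Letters

variable {ι : Type*} (Y : Finset ι) {w' : ι → ℝ → ℝ} {κ₁ : ℝ} (u h : ι → ℝ)

/-- `|w′_x(u)| ≤ κ₁|u|` ⟹ `|Σ_Y w′_x(u_x)h_x| ≤ κ₁Σ_Y|h_x||u_x|`. [folklore] -/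
theorem abs_lin_le (hw'b : ∀ x v, |w' x v| ≤ κ₁ * |v|) : |∑ x ∈ Y, w' x (u x) * h x| ≤ κ₁ * ∑ x ∈ Y, |h x| * |u x| := by
  refine (abs_sum_le_sum_abs _ _).trans ?_
  rw [mul_sum]
  refine sum_le_sum fun x _ => ?_
  rw [abs_mul]
  calc |w' x (u x)| * |h x| ≤ κ₁ * |u x| * |h x| := mul_le_mul_of_nonneg_right (hw'b x _) (abs_nonneg _)
    _ = κ₁ * (|h x| * |u x|) := by ring

/-- `|A|·|A| ≤ κ₁²·#Y·Σ_Y h_x²u_x²` (power mean of order 2). [folklore] -/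
theorem abs_lin_sq_le (hκ₁ : 0 ≤ κ₁) (hw'b : ∀ x v, |w' x v| ≤ κ₁ * |v|) :
    |∑ x ∈ Y, w' x (u x) * h x| * |∑ x ∈ Y, w' x (u x) * h x| ≤ κ₁ ^ 2 * Y.card * ∑ x ∈ Y, h x ^ 2 * u x ^ 2 := by
  have hA := abs_lin_le Y u h hw'b
  have hD0 : 0 ≤ ∑ x ∈ Y, |h x| * |u x| := sum_nonneg fun x _ => by positivity
  have hpm := pow_sum_le_card_mul_sum_pow (s := Y) (f := fun x => |h x| * |u x|) (fun x _ => by positivity) 1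
  have e : ∑ x ∈ Y, (|h x| * |u x|) ^ (1 + 1) = ∑ x ∈ Y, h x ^ 2 * u x ^ 2 :=
    sum_congr rfl fun x _ => by rw [mul_pow, sq_abs, sq_abs]
  rw [e, pow_one] at hpm
  calc |∑ x ∈ Y, w' x (u x) * h x| * |∑ x ∈ Y, w' x (u x) * h x|
      ≤ (κ₁ * ∑ x ∈ Y, |h x| * |u x|) * (κ₁ * ∑ x ∈ Y, |h x| * |u x|) := mul_le_mul hA hA (abs_nonneg _) (by positivity)
    _ = κ₁ ^ 2 * (∑ x ∈ Y, |h x| * |u x|) ^ (1 + 1) := by ring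
    _ ≤ κ₁ ^ 2 * (Y.card * ∑ x ∈ Y, h x ^ 2 * u x ^ 2) := mul_le_mul_of_nonneg_left hpm (sq_nonneg _)
    _ = κ₁ ^ 2 * Y.card * ∑ x ∈ Y, h x ^ 2 * u x ^ 2 := by ring

/-- `|A|·|A|·|A| ≤ κ₁³·#Y²·Σ_Y|h_x|³|u_x|³` (power mean of order 3). [folklore] -/
theorem abs_lin_cube_le (hκ₁ : 0 ≤ κ₁) (hw'b : ∀ x v, |w' x v| ≤ κ₁ * |v|) :
    |∑ x ∈ Y, w' x (u x) * h x| * |∑ x ∈ Y, w' x (u x) * h x| * |∑ x ∈ Y, w' x (u x) * h x| ≤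
      κ₁ ^ 3 * (Y.card : ℝ) ^ 2 * ∑ x ∈ Y, |h x| ^ 3 * |u x| ^ 3 := by
  have hA := abs_lin_le Y u h hw'b
  have hD0 : 0 ≤ ∑ x ∈ Y, |h x| * |u x| := sum_nonneg fun x _ => by positivity
  have hpm := pow_sum_le_card_mul_sum_pow (s := Y) (f := fun x => |h x| * |u x|) (fun x _ => by positivity) 2
  have e : ∑ x ∈ Y, (|h x| * |u x|) ^ (2 + 1) = ∑ x ∈ Y, |h x| ^ 3 * |u x| ^ 3 :=
    sum_congr rfl fun x _ => by rw [mul_pow]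
  rw [e] at hpm
  have hAA : |∑ x ∈ Y, w' x (u x) * h x| * |∑ x ∈ Y, w' x (u x) * h x| ≤
      (κ₁ * ∑ x ∈ Y, |h x| * |u x|) * (κ₁ * ∑ x ∈ Y, |h x| * |u x|) := mul_le_mul hA hA (abs_nonneg _) (by positivity)
  calc |∑ x ∈ Y, w' x (u x) * h x| * |∑ x ∈ Y, w' x (u x) * h x| * |∑ x ∈ Y, w' x (u x) * h x|
      ≤ (κ₁ * ∑ x ∈ Y, |h x| * |u x|) * (κ₁ * ∑ x ∈ Y, |h x| * |u x|) * (κ₁ * ∑ x ∈ Y, |h x| * |u x|) :=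
        mul_le_mul hAA hA (abs_nonneg _) (by positivity)
    _ = κ₁ ^ 3 * (∑ x ∈ Y, |h x| * |u x|) ^ (2 + 1) := by ring
    _ ≤ κ₁ ^ 3 * ((Y.card : ℝ) ^ 2 * ∑ x ∈ Y, |h x| ^ 3 * |u x| ^ 3) := mul_le_mul_of_nonneg_left hpm (pow_nonneg hκ₁ 3)
    _ = κ₁ ^ 3 * (Y.card : ℝ) ^ 2 * ∑ x ∈ Y, |h x| ^ 3 * |u x| ^ 3 := by ring

end Letters

/-! ## §3. Toy -/

/-- Toy (§1): for `Z ≡ 1` (`Z₁ = Z₂ = 0`, `z₃ = 0`) the third-order letter reads `|0| ≤ 0`. -/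
example : |((0 : ℝ) * (1 : ℝ) ^ 2 - 3 * 1 * 0 * 0 + 2 * (0 : ℝ) ^ 3) / (1 : ℝ) ^ 3| ≤
    |(0 : ℝ)| / 1 + 3 * (|(0 : ℝ)| / 1) * (|(0 : ℝ)| / 1) + 2 * (|(0 : ℝ)| / 1) ^ 3 :=
  abs_logThird_le one_pos

end Summit.QuantumFields.BalabanUV.T4Continuum.NE7b.SupLogThirdDerivative
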